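import Summits.QuantumFields.YangMills.Theorems.BalabanUVNodesK0BgProvisoOverRangeWitness

/-!
# K0′ ∕ RECORD13 gate ROW P11 — the LINEAR certificate (part 4): `BgProviso` over-ranged as typed, refuted at `N = 2` in the LINEAR room
# `α₀(g_n)·η_n² ≤ 2s`, `8s < min(cR·ε₀(g₀), εreg)`

Cell `pub-ymgap`, seat `pub-ymgap-dag-n21-c` (g4), `--supports stmt-QuantumFields-19902 --as helper` (K0′, ROW P11).  COUNT-NEUTRAL.

WHY A PART 4 (ERRATUM-1 to my bus prose; ym-nodeO-ideate P3 g28's located point, CORRECT): parts 1–2 read membership in `U^c_j(X, α₀, α₁)` through the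
normalised real TRACE, `1 − Re tr g∕2 = 2s²` for the witness while `dist ≤ 2s` — a room QUADRATIC in the threshold (`α₀(g_n)η_n² ≤ 2s² < min(…)²∕32`), which
at a ONE-step windowed run compares `g₁∕L²` with `g₀²` and fails for small `g₀` (it needs windowed histories of length `≳ log(C∕g₀)∕(2 log L)`).  THIS FILE reads
the same membership through an EIGENPAIR instead: the `Gᶜ`-orbit conjugates the plaquette variable, `∂𝐔₀(p) = u(x)⁻¹·U(∂p)·u(x)`, and if `U(∂p)e = μe` (`e ≠ 0`)
then `(u⁻¹U(∂p)u − 1)(u⁻¹e) = (μ − 1)(u⁻¹e)`, so `‖μ − 1‖ ≤ ‖∂𝐔₀(p) − 1‖_{op} < α₀ξ²` — LINEAR: for `g = diag(z, z̄)`, `‖z − 1‖ = 2s` exactly.  The refutation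
room becomes `α₀(g_n)·η_n² ≤ 2s`, `8s < min(cR·ε₀(g₀), εreg)`, i.e. `α₀(g_n)·L^{−2n} < min(cR·ε₀(g₀), εreg)∕4` — both sides `∝ g·polylog` ((2.28), (2.4)): at
`n = 1` a CONSTANTS condition `α₀(g₁) < (L²∕4)·min(cR·ε₀(g₀), εreg)`, each further step gaining `L² ≥ 169`; what stays (D1)-type is only «one or two β-steps
remain in ]0, γ]».

WHAT IS PROVED.  §1 `norm_sub_one_ge_of_eigen` (`WV = 1`, `Me = μe`, `e ≠ 0` ⇒ `‖μ − 1‖ ≤ ‖V·M·W − 1‖_{op}`, via `Matrix.l2_opNorm_mulVec`); §2 ★ `eigen_lt_of_mem_spaceI`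
(ANY setting with `ι = ιSU N`, ANY `Rz`: `ofBackgroundC ι U ∈ spaceI S Rz M j Y α₀ α₁`, `p ∈ plaqInside Y`, `U(∂p) e = μ e`, `e ≠ 0` ⇒ `‖μ − 1‖ < α₀·η_j²`);
§3 `bgProviso_forces_eigen_small` (the unranged token forces it on every retained small `W₀`, via part 1's all-empty sequence); §4 `exists_su2_witness_eigen`
(`diag(z, z̄)`: `dist1 ≤ 2s`, eigenpair `(z, e₀)`, `‖z − 1‖ = 2s`), ★ `not_bgProviso_of_smallRadius_linear`, ★ `not_provisos₁₂_of_window_smallRadius_linear`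
(`θ : Stage12Params F 2`; one windowed run of length `1 ≤ n ≤ K`, `M ≥ 1`, `0 ≤ s ≤ 1`, `8s < θ.s2.cR·ε₀(g₀)`, `8s < θ.ν.εreg`, **`α₀(g_n)·η_n² ≤ 2s`** ⇒ `¬ θ.Provisos₁₂ F 2`).

HONEST FRAMING.  A located TYPING defect (range of `X` in 11c's `BgProviso`), certified in a sharper room; nothing of Bałaban's contradicted or asserted; the
ranged token `BgProvisoΛ` (Record13 v1.1) is untouched (part 3 `…RangedAtEmptySeq`: vacuous exactly at the witness sequence); 0 `def`, 0 `sorry`; one finite `T⁴` at fixed `ε`;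
not continuum ∕ OS ∕ mass-gap ∕ Clay.
-/

open scoped Matrix.Norms.L2Operator

namespace Summit.QuantumFields.YangMills.Theorems.K0BgProvisoOverRange

open Literature.MathematicalPhysics.QuantumFieldTheory.Balaban1983to89
open Literature.MathematicalPhysics.QuantumFieldTheory.Balaban1983to89.Node00
open Literature.MathematicalPhysics.QuantumFieldTheory.Balaban1983to89.T4Continuum

noncomputable section

/-! ## §1  An eigenvalue of `M` bounds `‖V·M·W − 1‖_{op}` from below, linearly -/

/-- **`‖μ − 1‖ ≤ ‖V·M·W − 1‖_{op}`** whenever `W·V = 1`, `M e = μ e`, `e ≠ 0`: the vector `V e ≠ 0` is an eigenvector of `V·M·W − 1` for `μ − 1`. [folklore] -/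
theorem norm_sub_one_ge_of_eigen {N : ℕ} {M V W : Matrix (Fin N) (Fin N) ℂ} (hWV : W * V = 1) {e : Fin N → ℂ} (he : e ≠ 0) {μ : ℂ}
    (hμ : M.mulVec e = μ • e) : ‖μ - 1‖ ≤ ‖V * M * W - 1‖ := by
  set A : Matrix (Fin N) (Fin N) ℂ := V * M * W - 1 with hA
  -- the eigen-relation for `A` at `V e`
  have hWVe : W.mulVec (V.mulVec e) = e := by rw [Matrix.mulVec_mulVec, hWV, Matrix.one_mulVec]
  have hAe : A.mulVec (V.mulVec e) = (μ - 1) • (V.mulVec e) := by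
    rw [hA, Matrix.sub_mulVec, Matrix.one_mulVec, ← Matrix.mulVec_mulVec, ← Matrix.mulVec_mulVec, hWVe, hμ, Matrix.mulVec_smul, sub_smul,
      one_smul]
  -- `V e ≠ 0`
  have hVe : V.mulVec e ≠ 0 := by
    intro h0
    apply he
    rw [← hWVe, h0, Matrix.mulVec_zero]
  -- read in `ℂ^N` with the Euclidean norm
  set x : EuclideanSpace ℂ (Fin N) := (EuclideanSpace.equiv (Fin N) ℂ).symm (V.mulVec e) with hx
  have hxof : x.ofLp = V.mulVec e := rfl
  have hx0 : x ≠ 0 := by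
    intro h0
    apply hVe
    rw [← hxof, h0]
    rfl
  have hxpos : 0 < ‖x‖ := norm_pos_iff.mpr hx0
  have h1 := Matrix.l2_opNorm_mulVec A x
  have h2 : (EuclideanSpace.equiv (Fin N) ℂ).symm (A.mulVec x.ofLp) = (μ - 1) • x := by
    rw [hxof, hAe, map_smul]
  rw [h2, norm_smul] at h1
  exact le_of_mul_le_mul_right h1 hxpos

/-! ## §2  Membership in `U^c_j(X, α₀, α₁)` of record bounds every EIGENVALUE of `U(∂p)` within `α₀η_j²` of `1` -/

/-- **THE LINEAR READING OF (1.14) THROUGH THE ORBIT**: for ANY setting with `ι = ιSU N` and ANY residual recipe, if `ofBackgroundC ι U ∈ spaceI S Rz M j Y α₀ α₁`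
then at every plaquette `p` inside `Y` every eigenvalue `μ` of the matrix `U(∂p)` satisfies `‖μ − 1‖ < α₀·η_j²` (orbit representative `𝐔₀`, (iii) `‖∂𝐔₀(p) − 1‖ < α₀ξ²`,
`∂𝐔(p) = u(x)∂𝐔₀(p)u(x)⁻¹`, §1). [cite: Balaban1987RG1, (1.10)–(1.14) p.262] -/
theorem eigen_lt_of_mem_spaceI {N : ℕ} [NeZero N] {P : Params} (S : Sect2.Setting (MatA N) (SU N)) (hι : S.ι = ιSU N)
    (Rz : Sect2.Residual P (MatA N)) (M j : ℕ) (Y : Set (Site P 0)) (α₀ α₁ : ℝ) (U : GaugeField P 0 (SU N))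
    (hU : Sect2.ofBackgroundC S.ι U ∈ Sect2.spaceI S Rz M j Y α₀ α₁) {p : Plaq P 0} (hp : p ∈ plaqInside Y) {e : Fin N → ℂ} (he : e ≠ 0) {μ : ℂ}
    (hμ : ((GaugeField.plaqHol U p : SU N) : MatA N).mulVec e = μ • e) : ‖μ - 1‖ < α₀ * P.eta j ^ 2 := by
  obtain ⟨Ψ, hΨ, hΨU⟩ := hU
  obtain ⟨u, Φ₀, -, hSat, hact⟩ := hΨ
  obtain ⟨-, -, -, -, -, -, -, h3, -, -⟩ := hSat
  have hp' : p ∈ (B12RegularSpaces111.Frame.X (Sect2.frameI Rz M j Y)).plaqs := hp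
  have hlt := h3.plaq_lt p hp'
  have hΨ1 : Ψ.U = fun b => ιSU N (U b) := by
    funext b
    have hb := congrArg (fun φ : Sect2.CPair P (MatA N) => φ.1 b) hΨU
    simp only [Sect2.embedPair, Sect2.ofBackgroundC, hι] at hb
    exact Units.ext hb
  have hconj : B12RegularSpaces111.plaq Ψ.U p = u p.src * B12RegularSpaces111.plaq Φ₀.U p * (u p.src)⁻¹ := by
    rw [hact]
    exact B12RegularSpaces111Gauge.plaq_gaugeU u Φ₀.U p
  have hmat : ((B12RegularSpaces111.plaq Ψ.U p : (MatA N)ˣ) : MatA N) = ((GaugeField.plaqHol U p : SU N) : MatA N) := by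
    rw [hΨ1, plaq_comp_hom, B12RegularSpaces111.plaq_eq_plaqHol, coe_ιSU]
  have hWV : ((u p.src : (MatA N)ˣ) : MatA N) * (((u p.src)⁻¹ : (MatA N)ˣ) : MatA N) = 1 := by
    rw [← Units.val_mul, mul_inv_cancel, Units.val_one]
  have hΦ₀ : (((u p.src)⁻¹ : (MatA N)ˣ) : MatA N) * ((GaugeField.plaqHol U p : SU N) : MatA N) * ((u p.src : (MatA N)ˣ) : MatA N) =
      ((B12RegularSpaces111.plaq Φ₀.U p : (MatA N)ˣ) : MatA N) := by
    rw [← hmat, hconj, ← Units.val_mul, ← Units.val_mul]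
    congr 1
    group
  have key := norm_sub_one_ge_of_eigen (M := ((GaugeField.plaqHol U p : SU N) : MatA N))
    (V := (((u p.src)⁻¹ : (MatA N)ˣ) : MatA N)) (W := ((u p.src : (MatA N)ˣ) : MatA N)) hWV he hμ
  rw [hΦ₀] at key
  exact lt_of_le_of_lt key hlt

/-! ## §3  The unranged token forces the eigenvalue bound on every retained small field (all-empty sequence, parts 1∕3) -/

/-- **THE OVER-RANGE, LINEAR FORM.**  `BgProviso` AS TYPED over def-R's objects (`n ≥ 1`, `ι = ιSU N`) ⇒ for every scale-`0` configuration `W₀` within `εreg` and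
`cR·ε₀(g₀)` of `1`, every `1 ≤ j ≤ n`, every `X ∈ 𝐃_j`, every plaquette `p` inside `X` and every eigenpair `(μ, e)` of `W₀(∂p)`: `‖μ − 1‖ < α₀(g_j)·η_j²`.
[cite: Balaban1988Convergent, (2.27)–(2.28) p.259] -/
theorem bgProviso_forces_eigen_small {F : T4Family} {N : ℕ} [NeZero N] {K : ℕ} (S : Sect2.Setting (MatA N) (SU N)) (hι : S.ι = ιSU N)
    (Rz : Sect2.Residual (F.P K) (MatA N)) {ν : Stage7Numerics} {M : ℕ} {g : ℕ → ℝ} {n : ℕ} {cR : ℝ} (hn : 1 ≤ n)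
    (h : BgProviso F N K S Rz M n (regSuppOfRecord F N ν M g K n cR) (UbgMSOfRecord F N ν M g K n))
    (W₀ : GaugeField (F.P K) 0 (SU N)) (hreg : PlaqSmall ν.εreg W₀) (hsupp : PlaqSmall (cR * epsOfRecord ν g 0) W₀)
    {j : ℕ} (h1 : 1 ≤ j) (hj : j ≤ n) (X : (Sect2.domSys (F.P K) M j).Dom) {p : Plaq (F.P K) 0}
    (hp : p ∈ plaqInside (Sect2.domSites (F.P K) M j X)) {e : Fin N → ℂ} (he : e ≠ 0) {μ : ℂ}
    (hμ : ((GaugeField.plaqHol W₀ p : SU N) : MatA N).mulVec e = μ • e) :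
    ‖μ - 1‖ < S.lf.alpha0 (S.flow.g j) * (F.P K).eta j ^ 2 := by
  obtain ⟨s, hs⟩ := exists_seqOfRecord_forall_empty (F := F) ν M g K n
  obtain ⟨W, hW⟩ := exists_msField_zero W₀
  have hmem := (h s W (mem_regSuppOfRecord_of_forall_empty ν M g K n cR s hs W (hW ▸ hsupp)) j h1 hj X).1
  rw [UbgMSOfRecord_eq_W0_of_forall_empty ν M g K hn s hs W (hW ▸ hreg), hW] at hmem
  exact eigen_lt_of_mem_spaceI S hι Rz M j _ _ _ W₀ hmem hp he hμ

/-! ## §4  The `SU(2)` witness with its eigenpair; `¬ BgProviso` and `¬ Provisos₁₂` in the LINEAR room -/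

/-- **The `SU(2)` witness with an eigenpair**: for `0 ≤ s ≤ 1`, `g = diag(z, z̄)`, `z = (1 − 2s²) + 2is√(1 − s²)`: `‖g − 1‖_{op} ≤ 2s`, `g e₀ = z e₀` (`e₀ ≠ 0`) and
`‖z − 1‖ = 2s`. [folklore] -/
theorem exists_su2_witness_eigen (s : ℝ) (hs0 : 0 ≤ s) (hs1 : s ≤ 1) :
    ∃ (g : SU 2) (μ : ℂ) (e : Fin 2 → ℂ), dist1 g ≤ 2 * s ∧ e ≠ 0 ∧ ((g : MatA 2).mulVec e = μ • e) ∧ ‖μ - 1‖ = 2 * s := by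
  set c : ℝ := Real.sqrt (1 - s ^ 2) with hc
  have hc2 : c ^ 2 = 1 - s ^ 2 := by rw [hc, Real.sq_sqrt (by nlinarith)]
  set z : ℂ := ⟨1 - 2 * s ^ 2, 2 * s * c⟩ with hz
  have hnsq : Complex.normSq z = 1 := by
    rw [hz, Complex.normSq_mk]; nlinarith [hc2]
  have hzz : z * (starRingEnd ℂ) z = 1 := by
    rw [Complex.mul_conj, hnsq]; simp
  have hzz' : (starRingEnd ℂ) z * z = 1 := by rw [mul_comm, hzz]
  set v : Fin 2 → ℂ := ![z, (starRingEnd ℂ) z] with hv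
  set A : Matrix (Fin 2) (Fin 2) ℂ := Matrix.diagonal v with hA
  have hstar : ∀ i, v i * star (v i) = 1 := by
    intro i; fin_cases i
    · simpa [hv] using hzz
    · simpa [hv] using hzz'
  have hunit : A ∈ Matrix.unitaryGroup (Fin 2) ℂ := by
    rw [Matrix.mem_unitaryGroup_iff, hA, Matrix.star_eq_conjTranspose, Matrix.diagonal_conjTranspose, Matrix.diagonal_mul_diagonal,
      ← Matrix.diagonal_one]
    congr 1
    funext i
    exact hstar i
  have hdet : A.det = 1 := by
    rw [hA, Matrix.det_diagonal, Fin.prod_univ_two]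
    simpa [hv] using hzz
  have hz1 : ‖z - 1‖ = 2 * s := by
    have hre : (z - 1).re = -(2 * s ^ 2) := by simp [hz]
    have him : (z - 1).im = 2 * s * c := by simp [hz]
    rw [Complex.norm_def, Complex.normSq_apply, hre, him]
    have h4 : -(2 * s ^ 2) * -(2 * s ^ 2) + 2 * s * c * (2 * s * c) = (2 * s) ^ 2 := by nlinarith [hc2]
    rw [h4, Real.sqrt_sq (by linarith)]
  refine ⟨⟨A, Matrix.mem_specialUnitaryGroup_iff.mpr ⟨hunit, hdet⟩⟩, z, Pi.single 0 1, ?_, ?_, ?_, hz1⟩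
  · show ‖A - 1‖ ≤ 2 * s
    have hsub : A - 1 = Matrix.diagonal (v - 1) := by
      rw [hA, ← Matrix.diagonal_one, Matrix.diagonal_sub]; rfl
    rw [hsub, Matrix.l2_opNorm_diagonal]
    refine (pi_norm_le_iff_of_nonneg (by linarith)).mpr fun i => ?_
    fin_cases i
    · simpa [hv] using hz1.le
    · have : ‖(starRingEnd ℂ) z - 1‖ = 2 * s := by
        rw [← hz1, ← Complex.norm_conj (z - 1), map_sub, map_one]
      simpa [hv] using this.le
  · intro h0
    have := congrFun h0 0
    simp at this
  · show (Matrix.diagonal v).mulVec (Pi.single 0 1) = z • Pi.single 0 1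
    rw [Matrix.diagonal_mulVec_single]
    ext i
    fin_cases i <;> simp [hv]

/-- **`¬ BgProviso` AT `N = 2` IN THE LINEAR ROOM.**  For ANY setting with the embedding of record and ANY residual recipe, `n ≥ 1`, `M ≥ 1`: if some `0 ≤ s ≤ 1` has
`8s < cR·ε₀(g₀)`, `8s < εreg` and **`α₀(g_n)·η_n² ≤ 2s`**, then 11c's background proviso over def-R's objects fails as typed — the one-bond configuration carrying
`diag(z, z̄)` is retained and `εreg`-small, its background along the all-empty sequence is itself, and §3 forces `2s = ‖z − 1‖ < α₀(g_n)·η_n² ≤ 2s`.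
[cite: Balaban1988Convergent, (2.27)–(2.28) p.259] -/
theorem not_bgProviso_of_smallRadius_linear {F : T4Family} {K : ℕ} (S : Sect2.Setting (MatA 2) (SU 2)) (hι : S.ι = ιSU 2)
    (Rz : Sect2.Residual (F.P K) (MatA 2)) {ν : Stage7Numerics} {M : ℕ} {g : ℕ → ℝ} {n : ℕ} {cR : ℝ} (hn : 1 ≤ n) (hM : 1 ≤ M)
    (s : ℝ) (hs0 : 0 ≤ s) (hs1 : s ≤ 1) (hsupp : 8 * s < cR * epsOfRecord ν g 0) (hreg : 8 * s < ν.εreg)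
    (hα : S.lf.alpha0 (S.flow.g n) * (F.P K).eta n ^ 2 ≤ 2 * s) :
    ¬ BgProviso F 2 K S Rz M n (regSuppOfRecord F 2 ν M g K n cR) (UbgMSOfRecord F 2 ν M g K n) := by
  intro h
  obtain ⟨g₀, μ, e, hg₁, he, hμ, hμ1⟩ := exists_su2_witness_eigen s hs0 hs1
  obtain ⟨X, p, hp, -, -, -⟩ := exists_plaq_plaqInside_domSites (P := F.P K) (by simp) M n (two_le_side K hM hn)
  obtain ⟨U, hUp, hUq⟩ := exists_oneBond_cfg (one_lt_sitesPerDir_zero (F.P K)) g₀ p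
  have hregU : PlaqSmall ν.εreg U := fun q => by linarith [hUq q]
  have hsuppU : PlaqSmall (cR * epsOfRecord ν g 0) U := fun q => by linarith [hUq q]
  have hμ' : ((GaugeField.plaqHol U p : SU 2) : MatA 2).mulVec e = μ • e := by rw [hUp]; exact hμ
  have hlt := bgProviso_forces_eigen_small S hι Rz hn h U hregU hsuppU hn le_rfl X hp he hμ'
  rw [hμ1] at hlt
  linarith

/-- **THE STAGE-12 COROLLARY IN THE LINEAR ROOM (K0′'s `bg` field, N = 2).**  At ANY `θ : Stage12Params F 2` admitting ONE run `p` and ONE length `1 ≤ n ≤ K` whose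
history lies in the window `]0, γ]` up to `n`, with `M ≥ 1` and some `0 ≤ s ≤ 1`, `8s < cR·ε₀(g₀)`, `8s < εreg`, **`α₀(g_n)·η_n² ≤ 2s`** — i.e.
`α₀(g_n)·L^{−2n} < min(cR·ε₀(g₀), εreg)∕4`, both sides `∝ g·polylog` — the displayed provisos `Provisos₁₂` FAIL through `bg` as typed.  (The re-keyed
`Provisos₁₃.bg` over def-R's ranged `BgProvisoΛ` is untouched, part 3.) [cite: Balaban1988Convergent, (2.27)–(2.28) p.259, (2.4) p.255] -/
theorem not_provisos₁₂_of_window_smallRadius_linear {F : T4Family} (θ : Stage12Params F 2) (p : B12.RunParams) {n : ℕ} (hn : 1 ≤ n)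
    (hnK : n ≤ p.K) (hw : Step.InInterval θ.γ n (gOfRecord₁₀ F 2 θ.toStage9Params p)) (hM : 1 ≤ θ.τ9.M) (s : ℝ) (hs0 : 0 ≤ s) (hs1 : s ≤ 1)
    (hsupp : 8 * s < θ.s2.cR * epsOfRecord θ.ν (gOfRecord₁₀ F 2 θ.toStage9Params p) 0) (hreg : 8 * s < θ.ν.εreg)
    (hα : (lfOfRecord₁₂ F 2 θ).alpha0 (gOfRecord₁₀ F 2 θ.toStage9Params p n) * (F.P p.K).eta n ^ 2 ≤ 2 * s) :
    ¬ θ.Provisos₁₂ F 2 := by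
  intro hP
  obtain ⟨n', rfl⟩ : ∃ n', n = n' + 1 := ⟨n - 1, by omega⟩
  have hbg : BgProviso F 2 p.K (settingOfRecord₁₂ F 2 θ p) (θ.Rz p.K) θ.τ9.M (n' + 1)
      (regSuppOfRecord F 2 θ.ν θ.τ9.M (gOfRecord₁₀ F 2 θ.toStage9Params p) p.K (n' + 1) θ.s2.cR)
      (UbgMSOfRecord F 2 θ.ν θ.τ9.M (gOfRecord₁₀ F 2 θ.toStage9Params p) p.K (n' + 1)) := hP.bg p (n' + 1) hnK hw
  exact not_bgProviso_of_smallRadius_linear (settingOfRecord₁₂ F 2 θ p) rfl (θ.Rz p.K) hn hM s hs0 hs1 hsupp hreg hα hbg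

/-! ## §5 (v1.1)  GENERAL `N ≥ 2`: node00-def-P11 g0's operator-norm witness FOLDED VERBATIM (dag-lead WORDS-131 (2) ∕ REBALANCE №63 — one linear certificate),
and the general-`N` refutations it yields through §3 -/

section GeneralN

open scoped Matrix

variable {N : ℕ}

/-- For a unit `w` of `M_N(ℂ)` and a diagonal matrix `D = diagonal v`, the conjugate `w D w⁻¹` is at operator-norm distance at least
`|v i − 1|` from `1`, for every `i` (eigenvector `w eᵢ`).  (node00-def-P11 g0, folded verbatim.) [folklore] -/
theorem norm_apply_sub_one_le_norm_conj_diagonal_sub_one (w : (MatA N)ˣ) (v : Fin N → ℂ) (i : Fin N) :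
    ‖v i - 1‖ ≤ ‖(w : MatA N) * Matrix.diagonal v * ((w⁻¹ : (MatA N)ˣ) : MatA N) - 1‖ := by
  set B : MatA N := (w : MatA N) * Matrix.diagonal v * ((w⁻¹ : (MatA N)ˣ) : MatA N) - 1 with hB
  set y : Fin N → ℂ := (w : MatA N) *ᵥ Pi.single i 1 with hy
  have hDe : Matrix.diagonal v *ᵥ (Pi.single i (1 : ℂ)) = v i • Pi.single i (1 : ℂ) := by
    rw [Matrix.diagonal_mulVec_single, ← smul_eq_mul, Pi.single_smul']
  have hBy : B *ᵥ y = (v i - 1) • y := by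
    have h1 : ((w : MatA N) * Matrix.diagonal v * ((w⁻¹ : (MatA N)ˣ) : MatA N)) *ᵥ y = v i • y := by
      rw [hy, Matrix.mulVec_mulVec, Units.inv_mul_cancel_right, ← Matrix.mulVec_mulVec, hDe, Matrix.mulVec_smul]
    rw [hB, Matrix.sub_mulVec, h1, Matrix.one_mulVec, sub_smul, one_smul]
  have hy0 : y ≠ 0 := by
    intro h0
    have h2 : ((w⁻¹ : (MatA N)ˣ) : MatA N) *ᵥ y = Pi.single i 1 := by
      rw [hy, Matrix.mulVec_mulVec, Units.inv_mul, Matrix.one_mulVec]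
    rw [h0, Matrix.mulVec_zero] at h2
    have h3 := congrFun h2 i
    simp at h3
  set x : EuclideanSpace ℂ (Fin N) := WithLp.toLp 2 y with hx
  have hx0 : x ≠ 0 := by
    rw [hx]; exact fun h => hy0 ((WithLp.toLp_eq_zero 2).mp h)
  have hxpos : 0 < ‖x‖ := norm_pos_iff.mpr hx0
  have hTx : Matrix.toEuclideanCLM (n := Fin N) (𝕜 := ℂ) B x = (v i - 1) • x := by
    rw [hx, Matrix.toEuclideanCLM_toLp, hBy, WithLp.toLp_smul]
  have hle : ‖(v i - 1) • x‖ ≤ ‖B‖ * ‖x‖ := by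
    rw [← hTx, ← Matrix.l2_opNorm_toEuclideanCLM]
    exact (Matrix.toEuclideanCLM (n := Fin N) (𝕜 := ℂ) B).le_opNorm x
  rw [norm_smul] at hle
  exact le_of_mul_le_mul_right hle hxpos

/-- A unit complex number at prescribed distance `t ∈ [0, 2]` from `1`.  (node00-def-P11 g0, folded verbatim.) [folklore] -/
theorem exists_unit_complex_norm_sub_one_eq {t : ℝ} (h0 : 0 ≤ t) (h2 : t ≤ 2) :
    ∃ c : ℂ, ‖c‖ = 1 ∧ ‖c - 1‖ = t := by
  have h4 : 0 ≤ 1 - t ^ 2 / 4 := by nlinarith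
  refine ⟨⟨1 - t ^ 2 / 2, t * Real.sqrt (1 - t ^ 2 / 4)⟩, ?_, ?_⟩
  · have hsq : (1 - t ^ 2 / 2) * (1 - t ^ 2 / 2) + t * Real.sqrt (1 - t ^ 2 / 4) * (t * Real.sqrt (1 - t ^ 2 / 4)) = 1 := by
      have hs := Real.mul_self_sqrt h4
      nlinarith [hs]
    rw [Complex.norm_def, Complex.normSq_apply]
    simp only [hsq, Real.sqrt_one]
  · have hsq : (1 - t ^ 2 / 2 - 1) * (1 - t ^ 2 / 2 - 1) + t * Real.sqrt (1 - t ^ 2 / 4) * (t * Real.sqrt (1 - t ^ 2 / 4)) = t * t := by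
      have hs := Real.mul_self_sqrt h4
      nlinarith [hs]
    rw [Complex.norm_def, Complex.normSq_apply]
    simp only [Complex.sub_re, Complex.one_re, Complex.sub_im, Complex.one_im, sub_zero, hsq]
    exact Real.sqrt_mul_self h0

/-- For `N ≥ 2` and `t ∈ [0, 2]`: a vector of phases `v` on `Fin N` with `|v i| = 1`, `∏ v i = 1`, `|v 0 − 1| = t` and `|v i − 1| ≤ t` for all `i`
(`v = (c, c̄, 1, …, 1)`).  (node00-def-P11 g0, folded verbatim.) [folklore] -/
theorem exists_phases [NeZero N] (hN : 2 ≤ N) {t : ℝ} (h0 : 0 ≤ t) (h2 : t ≤ 2) :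
    ∃ v : Fin N → ℂ, (∀ i, ‖v i‖ = 1) ∧ (∏ i, v i) = 1 ∧ ‖v 0 - 1‖ = t ∧ ∀ i, ‖v i - 1‖ ≤ t := by
  obtain ⟨c, hc1, hct⟩ := exists_unit_complex_norm_sub_one_eq h0 h2
  obtain ⟨n, rfl⟩ : ∃ n, N = n + 2 := ⟨N - 2, by omega⟩
  refine ⟨Fin.cons c (Fin.cons (starRingEnd ℂ c) fun _ => 1), ?_, ?_, ?_, ?_⟩
  · intro i
    refine Fin.cases ?_ (fun j => ?_) i
    · simpa using hc1
    · refine Fin.cases ?_ (fun k => ?_) j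
      · simpa [Complex.norm_conj] using hc1
      · simp
  · rw [Fin.prod_univ_succ, Fin.prod_univ_succ]
    simp only [Fin.cons_zero, Fin.cons_succ, Finset.prod_const_one, mul_one]
    rw [Complex.mul_conj, Complex.normSq_eq_norm_sq, hc1]
    simp
  · simpa using hct
  · intro i
    refine Fin.cases ?_ (fun j => ?_) i
    · simp [hct]
    · refine Fin.cases ?_ (fun k => ?_) j
      · have : ‖starRingEnd ℂ c - 1‖ = ‖c - 1‖ := by
          rw [← Complex.norm_conj (c - 1), map_sub, map_one]
        simp [this, hct]
      · simp [h0]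

/-- **A special unitary matrix at prescribed distance from `1`, whose every conjugate keeps that distance**: for `N ≥ 2` and `t ∈ [0, 2]` there is
`D ∈ SU(N)` with `dist1 D ≤ t` and `t ≤ ‖w D w⁻¹ − 1‖` for EVERY unit `w` of `M_N(ℂ)`.  (node00-def-P11 g0, folded verbatim.) [folklore] -/
theorem exists_su_conj_norm_sub_one_ge [NeZero N] (hN : 2 ≤ N) {t : ℝ} (h0 : 0 ≤ t) (h2 : t ≤ 2) :
    ∃ D : SU N, dist1 D ≤ t ∧ ∀ w : (MatA N)ˣ, t ≤ ‖(w : MatA N) * (D : MatA N) * ((w⁻¹ : (MatA N)ˣ) : MatA N) - 1‖ := by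
  obtain ⟨v, hv1, hprod, hv0, hvle⟩ := exists_phases hN h0 h2
  have hunit : Matrix.diagonal v ∈ Matrix.unitaryGroup (Fin N) ℂ := by
    rw [Matrix.mem_unitaryGroup_iff, Matrix.star_eq_conjTranspose, Matrix.diagonal_conjTranspose, Matrix.diagonal_mul_diagonal,
      ← Matrix.diagonal_one]
    congr 1
    funext i
    have h := hv1 i
    rw [Pi.star_apply, Complex.star_def, Complex.mul_conj, Complex.normSq_eq_norm_sq, h]
    simp
  have hsu : Matrix.diagonal v ∈ Matrix.specialUnitaryGroup (Fin N) ℂ := by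
    rw [Matrix.mem_specialUnitaryGroup_iff]
    exact ⟨hunit, by rw [Matrix.det_diagonal, hprod]⟩
  refine ⟨⟨Matrix.diagonal v, hsu⟩, ?_, fun w => ?_⟩
  · show ‖(Matrix.diagonal v : MatA N) - 1‖ ≤ t
    rw [← Matrix.diagonal_one, Matrix.diagonal_sub, Matrix.l2_opNorm_diagonal]
    exact (pi_norm_le_iff_of_nonneg h0).mpr fun i => by simpa using hvle i
  · calc t = ‖v 0 - 1‖ := hv0.symm
      _ ≤ _ := norm_apply_sub_one_le_norm_conj_diagonal_sub_one w v 0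

/-- **The general-`N` witness with its eigenpair** (`N ≥ 2`, `0 ≤ s ≤ 1`): `g = diag(c, c̄, 1, …, 1) ∈ SU(N)` with `dist1 g ≤ 2s`, `g e₀ = c e₀` and `‖c − 1‖ = 2s`
(from `exists_phases`). [folklore] -/
theorem exists_suN_witness_eigen [NeZero N] (hN : 2 ≤ N) (s : ℝ) (hs0 : 0 ≤ s) (hs1 : s ≤ 1) :
    ∃ (g : SU N) (μ : ℂ) (e : Fin N → ℂ), dist1 g ≤ 2 * s ∧ e ≠ 0 ∧ ((g : MatA N).mulVec e = μ • e) ∧ ‖μ - 1‖ = 2 * s := by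
  obtain ⟨v, hv1, hprod, hv0, hvle⟩ := exists_phases hN (t := 2 * s) (by linarith) (by linarith)
  have hunit : Matrix.diagonal v ∈ Matrix.unitaryGroup (Fin N) ℂ := by
    rw [Matrix.mem_unitaryGroup_iff, Matrix.star_eq_conjTranspose, Matrix.diagonal_conjTranspose, Matrix.diagonal_mul_diagonal,
      ← Matrix.diagonal_one]
    congr 1
    funext i
    have h := hv1 i
    rw [Pi.star_apply, Complex.star_def, Complex.mul_conj, Complex.normSq_eq_norm_sq, h]
    simp
  have hsu : Matrix.diagonal v ∈ Matrix.specialUnitaryGroup (Fin N) ℂ := by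
    rw [Matrix.mem_specialUnitaryGroup_iff]
    exact ⟨hunit, by rw [Matrix.det_diagonal, hprod]⟩
  refine ⟨⟨Matrix.diagonal v, hsu⟩, v 0, Pi.single 0 1, ?_, ?_, ?_, hv0⟩
  · show ‖(Matrix.diagonal v : MatA N) - 1‖ ≤ 2 * s
    rw [← Matrix.diagonal_one, Matrix.diagonal_sub, Matrix.l2_opNorm_diagonal]
    exact (pi_norm_le_iff_of_nonneg (by linarith)).mpr fun i => by simpa using hvle i
  · intro h0
    have := congrFun h0 0
    simp at this
  · show Matrix.diagonal v *ᵥ Pi.single 0 1 = v 0 • Pi.single 0 1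
    rw [Matrix.diagonal_mulVec_single, ← smul_eq_mul, Pi.single_smul']

/-- **`¬ BgProviso` AT EVERY `N ≥ 2` IN THE LINEAR ROOM** (any setting with `ι = ιSU N`, any residual recipe, `n ≥ 1`, `M ≥ 1`; `0 ≤ s ≤ 1`, `8s < cR·ε₀(g₀)`,
`8s < εreg`, `α₀(g_n)·η_n² ≤ 2s`). [cite: Balaban1988Convergent, (2.27)–(2.28) p.259] -/
theorem not_bgProviso_of_smallRadius_linear_general [NeZero N] (hN : 2 ≤ N) {F : T4Family} {K : ℕ} (S : Sect2.Setting (MatA N) (SU N))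
    (hι : S.ι = ιSU N) (Rz : Sect2.Residual (F.P K) (MatA N)) {ν : Stage7Numerics} {M : ℕ} {g : ℕ → ℝ} {n : ℕ} {cR : ℝ} (hn : 1 ≤ n)
    (hM : 1 ≤ M) (s : ℝ) (hs0 : 0 ≤ s) (hs1 : s ≤ 1) (hsupp : 8 * s < cR * epsOfRecord ν g 0) (hreg : 8 * s < ν.εreg)
    (hα : S.lf.alpha0 (S.flow.g n) * (F.P K).eta n ^ 2 ≤ 2 * s) :
    ¬ BgProviso F N K S Rz M n (regSuppOfRecord F N ν M g K n cR) (UbgMSOfRecord F N ν M g K n) := by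
  intro h
  obtain ⟨g₀, μ, e, hg₁, he, hμ, hμ1⟩ := exists_suN_witness_eigen hN s hs0 hs1
  obtain ⟨X, p, hp, -, -, -⟩ := exists_plaq_plaqInside_domSites (P := F.P K) (by simp) M n (two_le_side K hM hn)
  obtain ⟨U, hUp, hUq⟩ := exists_oneBond_cfg (one_lt_sitesPerDir_zero (F.P K)) g₀ p
  have hregU : PlaqSmall ν.εreg U := fun q => by linarith [hUq q]
  have hsuppU : PlaqSmall (cR * epsOfRecord ν g 0) U := fun q => by linarith [hUq q]
  have hμ' : ((GaugeField.plaqHol U p : SU N) : MatA N).mulVec e = μ • e := by rw [hUp]; exact hμ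
  have hlt := bgProviso_forces_eigen_small S hι Rz hn h U hregU hsuppU hn le_rfl X hp he hμ'
  rw [hμ1] at hlt
  linarith

/-- **THE STAGE-12 COROLLARY AT EVERY `N ≥ 2` IN THE LINEAR ROOM**: at ANY `θ : Stage12Params F N` with ONE windowed run of length `1 ≤ n ≤ K`, `M ≥ 1` and the linear
smallness at `(p, n)`: `¬ θ.Provisos₁₂ F N` through the unranged `bg` alone. [cite: Balaban1988Convergent, (2.27)–(2.28) p.259] -/
theorem not_provisos₁₂_of_window_smallRadius_linear_general [NeZero N] (hN : 2 ≤ N) {F : T4Family} (θ : Stage12Params F N) (p : B12.RunParams)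
    {n : ℕ} (hn : 1 ≤ n) (hnK : n ≤ p.K) (hw : Step.InInterval θ.γ n (gOfRecord₁₀ F N θ.toStage9Params p)) (hM : 1 ≤ θ.τ9.M) (s : ℝ)
    (hs0 : 0 ≤ s) (hs1 : s ≤ 1) (hsupp : 8 * s < θ.s2.cR * epsOfRecord θ.ν (gOfRecord₁₀ F N θ.toStage9Params p) 0) (hreg : 8 * s < θ.ν.εreg)
    (hα : (lfOfRecord₁₂ F N θ).alpha0 (gOfRecord₁₀ F N θ.toStage9Params p n) * (F.P p.K).eta n ^ 2 ≤ 2 * s) :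
    ¬ θ.Provisos₁₂ F N := by
  intro hP
  obtain ⟨n', rfl⟩ : ∃ n', n = n' + 1 := ⟨n - 1, by omega⟩
  have hbg : BgProviso F N p.K (settingOfRecord₁₂ F N θ p) (θ.Rz p.K) θ.τ9.M (n' + 1)
      (regSuppOfRecord F N θ.ν θ.τ9.M (gOfRecord₁₀ F N θ.toStage9Params p) p.K (n' + 1) θ.s2.cR)
      (UbgMSOfRecord F N θ.ν θ.τ9.M (gOfRecord₁₀ F N θ.toStage9Params p) p.K (n' + 1)) := hP.bg p (n' + 1) hnK hw
  exact not_bgProviso_of_smallRadius_linear_general hN (settingOfRecord₁₂ F N θ p) rfl (θ.Rz p.K) hn hM s hs0 hs1 hsupp hreg hα hbg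

end GeneralN

end

end Summit.QuantumFields.YangMills.Theorems.K0BgProvisoOverRange
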